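import Summits.QuantumFields.QCD.Theorems.QuarksAsStableActionStableActionBridgeWilsonTransferForm
import Summits.QuantumFields.QCD.Theorems.QuarksAsStableActionStableActionBridgeChainBlockSmit
import Summits.QuantumFields.QCD.Theorems.QuarksAsStableActionStableActionBridgeDressedCoreDict
import Summits.QuantumFields.QCD.Theorems.QuarksAsStableActionStableActionBridgeSliceGaugeRotDict
import Summits.QuantumFields.QCD.Theorems.QuarksAsStableActionStableActionBridgeConjTransport
import Summits.QuantumFields.QCD.Theorems.QuarksAsStableActionStableActionBridgeFermionSliceOpCovariance

/-!
# Lüscher's transfer-matrix form of the Wilson fermion determinant in Smit's slice vocabulary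
(crux `QuarksAsStableAction.StableActionBridge`, item stmt-QuantumFields-9737, line `Sketch`;
registered stub `wilson_det_eq_smit_transfer_form`, capstone A of the F3 dictionary)

For a four-torus `SU(3)` gauge field `U` on `(ℤ/L)⁴` (`L ≥ 1`), one flavour of `r = 1` Wilson quarks
of bare mass `m > −1` in the fundamental representation,

  `det D_W[U] = ∏_t det A(U_t)² · det (1 − ∏_{t=0}^{L−1} M_F(U_t) G_t)`,

where `U_t : (x⃗, j) ↦ U((t, x⃗), j+1)` is the slice configuration at time `t`,
`A(U_t) = sliceMassHop U_t m` is Smit's spin-blind mass-plus-hop matrix (its squared determinant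
is the Dirac-sea factor `(det A_red)² = e^{Tr P⁺ ln A}` of the fermionic transfer operator
`T̂_F(U_t) = (det A_red)² Γ(M_F(U_t))`, Smit (6.91)), `M_F(U_t) = fermionSliceMatrix U_t m` is the
one-particle matrix of `T̂_F(U_t)` and `G_t = sliceGaugeRot (y ↦ U((t, y), 0))` is the one-particle
gauge rotation by the temporal links leaving slice `t` (Smit §4.6 (4.124)–(4.126)).  Time is
PERIODIC for `wilsonDirac`, whence the `det (1 − ·)` — the `(−1)^F`-twisted Fock trace
("supertrace") `Tr[(−1)^F ∏_t Γ(M_F(U_t)) Γ(G_t)]` — instead of the trace `det (1 + ·)` of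
antiperiodic time.

Assembly of the landed pieces: Lüscher's form `det D_W = (∏_t det E_t) · det (1 − ∏_t M_t W_t)`
(`wilson_det_transfer_form`, `Nc = 3`, `ρ` the defining representation of `SU(3)`); the chain
blocks `det E_t = det A(U_t)²` (`det_chainBlock_eq_det_sliceMassHop_sq`); the dressed one-step
cores `M_t = reindex (V M_F(U_t) V⁻¹)`, `V = 1 ⊗ γ₄γ₅` (`dressedCore_timeSlice_eq`); the temporal
transporters `W_t = reindex G_t` (`sliceGaugeRot_timeSlice_apply`); `reindex` along
`Fin 1 × X ≃ X` is multiplicative and unital, so it passes through the ordered product and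
`det (1 − reindex Q) = det (1 − Q)`; finally the spin rotation `V` commutes with the spin-blind
`G_t` (`sliceKron_one_mul_sliceGaugeRot_comm`) and telescopes out of the product
(`det_one_sub_prod_conj`).  Pure theorem file (no definitions).

References: M. Lüscher, Commun. Math. Phys. 54 (1977) 283 [Luscher1977, pp. 283–292]; J. Smit,
*Introduction to Quantum Fields on a Lattice*, §6.5 (6.87)–(6.91) [Smit2023, §6.5 (6.87)–(6.91)].
-/

noncomputable section

namespace Summit.QuantumFields.QCD.Cruxes.StableActionBridge.Sketch

open MeasureTheory Matrix Literature.MathematicalPhysics.QuantumFieldTheory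
  Literature.MathematicalPhysics.QuantumLattice
open Literature.Probability.LatticeModels (TorusSite)

namespace SmitTransferForm

/-! ### The inverse spin rotation and the transport of `reindex` through the ordered product -/

/-- `(γ₅γ₄)(γ₄γ₅) = 1` (`γ₄² = 1 = γ₅²`). [folklore] -/
theorem gamma50_mul_gamma05 :
    gammaFive * euclideanGamma 0 * (euclideanGamma 0 * gammaFive) = 1 := by
  rw [Matrix.mul_assoc, ← Matrix.mul_assoc (euclideanGamma 0), euclideanGamma_mul_self,
    Matrix.one_mul, SliceGammaConjugation.gammaFive_mul_self_and_mul_euclideanGamma.1]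

/-- `(1 ⊗ γ₅γ₄)(1 ⊗ γ₄γ₅) = 1` on the slice quark modes: `V⁻¹ V = 1` for the spin rotation
`V = 1 ⊗ γ₄γ₅`. [folklore] -/
theorem gamma50_sliceKron_mul_gamma05_sliceKron {Nf S : ℕ} [NeZero S] :
    sliceKron (Nf := Nf) (S := S) 1 (gammaFive * euclideanGamma 0) *
        sliceKron 1 (euclideanGamma 0 * gammaFive) = 1 := by
  rw [SliceNilpotent.sliceKron_mul, Matrix.mul_one, gamma50_mul_gamma05,
    SliceNilpotent.sliceKron_one_one]

/-- `Matrix.reindex e e` passes through an ordered `List` product (it is multiplicative and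
unital, being the algebra isomorphism `Matrix.reindexAlgEquiv`). [folklore] -/
theorem prod_map_reindex {m n : Type*} [Fintype m] [Fintype n] [DecidableEq m] [DecidableEq n]
    (e : m ≃ n) (Y : ℕ → Matrix m m ℂ) :
    ∀ l : List ℕ,
      (l.map fun i => Matrix.reindex e e (Y i)).prod = Matrix.reindex e e (l.map Y).prod
  | [] => by
    rw [List.map_nil, List.map_nil, List.prod_nil, List.prod_nil,
      ← Matrix.coe_reindexAlgEquiv ℂ ℂ e, map_one]
  | a :: l => by
    rw [List.map_cons, List.prod_cons, prod_map_reindex e Y l, List.map_cons, List.prod_cons,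
      FermionSliceOpCovariance.reindex_mul_reindex]

/-- `det (1 − reindex e e P) = det (1 − P)` (`reindex e e` is a unital ring isomorphism and
preserves determinants). [folklore] -/
theorem det_one_sub_reindex {m n : Type*} [Fintype m] [Fintype n] [DecidableEq m]
    [DecidableEq n] (e : m ≃ n) (P : Matrix m m ℂ) :
    (1 - Matrix.reindex e e P).det = (1 - P).det := by
  have h : (1 : Matrix n n ℂ) - Matrix.reindex e e P = Matrix.reindex e e (1 - P) := by
    simp only [← Matrix.coe_reindexAlgEquiv ℂ ℂ e, map_sub, map_one]
  rw [h, Matrix.det_reindex_self]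

/-- **Transport of a reindexed similarity through the time-ordered product.**  For
`V' V = 1 = V V'` and transporters `G_i` commuting with `V`,
`det (1 − ∏_{i<L} reindex (V X_i V') · reindex G_i) = det (1 − ∏_{i<L} X_i G_i)`:
`reindex` is multiplicative and unital, and the conjugations telescope
(`det_one_sub_prod_conj`). [folklore] -/
theorem det_one_sub_prod_reindex_conj {m n : Type} [Fintype m] [Fintype n] [DecidableEq m]
    [DecidableEq n] (e : m ≃ n) (V V' : Matrix m m ℂ) (X G : ℕ → Matrix m m ℂ) (L : ℕ)
    (hV'V : V' * V = 1) (hVV' : V * V' = 1) (hG : ∀ i, G i * V = V * G i) :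
    (1 - ((List.range L).map fun i =>
        Matrix.reindex e e (V * X i * V') * Matrix.reindex e e (G i)).prod).det =
      (1 - ((List.range L).map fun i => X i * G i).prod).det := by
  calc (1 - ((List.range L).map fun i =>
          Matrix.reindex e e (V * X i * V') * Matrix.reindex e e (G i)).prod).det
      = (1 - ((List.range L).map fun i => Matrix.reindex e e (V * X i * V' * G i)).prod).det := by
        simp only [← FermionSliceOpCovariance.reindex_mul_reindex]
    _ = (1 - Matrix.reindex e e ((List.range L).map fun i => V * X i * V' * G i).prod).det := by
        rw [prod_map_reindex]
    _ = (1 - ((List.range L).map fun i => V * X i * V' * G i).prod).det := det_one_sub_reindex e _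
    _ = (1 - ((List.range L).map fun i => X i * G i).prod).det :=
        det_one_sub_prod_conj m V V' X G L hV'V hVV' hG

/-! ### Dictionary: the temporal transporter is the reindexed one-particle gauge rotation -/

/-- **`W_t = reindex G_t`**: the temporal transporter of `wilson_det_transfer_form` at time `t`
(fundamental representation of `SU(3)`) is Smit's one-particle gauge rotation `sliceGaugeRot` of
the one-flavour slice quark modes by the temporal links `y ↦ U((t, y), 0)`, reindexed along
`Fin 1 × X ≃ X` (entrywise: `sliceGaugeRot_timeSlice_apply`).
[cite: Smit2023, §4.6 (4.124)–(4.126)] -/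
theorem transporter_eq_reindex (L : ℕ) [NeZero L]
    (U : GaugeConfig 4 L (Matrix.specialUnitaryGroup (Fin 3) ℂ)) (t : ZMod L) :
    (Matrix.of fun a b : TorusSite 3 L × Fin 3 × Fin 4 =>
        if a.1 = b.1 ∧ a.2.2 = b.2.2 then
          fundamentalRep (Fin 3) (U ((Fin.cons t a.1 : TorusSite 4 L), 0)) a.2.1 b.2.1 else 0) =
      Matrix.reindex (Equiv.uniqueProd (TorusSite 3 L × Fin 3 × Fin 4) (Fin 1))
        (Equiv.uniqueProd (TorusSite 3 L × Fin 3 × Fin 4) (Fin 1))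
        (sliceGaugeRot (Nf := 1) fun y : TorusSite 3 L => U ((Fin.cons t y : TorusSite 4 L), 0)) := by
  ext a b
  rw [Matrix.reindex_apply, Matrix.submatrix_apply, Equiv.uniqueProd_symm_apply,
    Equiv.uniqueProd_symm_apply, Fin.default_eq_zero, Matrix.of_apply]
  exact (sliceGaugeRot_timeSlice_apply L U t a b).symm

end SmitTransferForm

/-- **Capstone A of the F3 dictionary (stub `wilson_det_eq_smit_transfer_form` of line `Sketch`):
Lüscher's transfer-matrix form of the Wilson fermion determinant in Smit's slice vocabulary.**
For an `SU(3)` gauge field `U` on the four-torus `(ℤ/L)⁴`, one flavour of `r = 1` Wilson quarks of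
bare mass `m > −1` (fundamental representation),
`det D_W[U] = ∏_t det A(U_t)² · det (1 − ∏_{t=0}^{L−1} M_F(U_t) G_t)` with `U_t` the slice
configuration `(x⃗, j) ↦ U((t, x⃗), j+1)`, `A(U_t) = sliceMassHop U_t m` (Dirac-sea factor
`(det A_red)²` of `T̂_F(U_t)`), `M_F(U_t) = fermionSliceMatrix U_t m` the one-particle matrix of the
fermionic transfer operator and `G_t = sliceGaugeRot (y ↦ U((t, y), 0))` the one-particle gauge
rotation by the temporal links; periodic time gives the `det (1 − ·)` (supertrace) form.
[cite: Luscher1977, pp. 283–292] [cite: Smit2023, §6.5 (6.87)–(6.91)] -/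
theorem wilson_det_eq_smit_transfer_form : ∀ (L : ℕ) [NeZero L] (U : GaugeConfig 4 L (Matrix.specialUnitaryGroup (Fin 3) ℂ)) (m : ℝ), -1 < m → (wilsonDirac (fundamentalRep (Fin 3)) U m 1).det = (∏ t : ZMod L, (sliceMassHop (fun e : Edge 3 L => U ((Fin.cons t e.1 : TorusSite 4 L), e.2.succ)) (fun _ : Fin 1 => m)).det ^ 2) * (1 - ((List.range L).map fun i : ℕ => fermionSliceMatrix (fun e : Edge 3 L => U ((Fin.cons (i : ZMod L) e.1 : TorusSite 4 L), e.2.succ)) (fun _ : Fin 1 => m) * sliceGaugeRot (Nf := 1) (fun y : TorusSite 3 L => U ((Fin.cons (i : ZMod L) y : TorusSite 4 L), 0))).prod).det := by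
  intro L _ U m hm
  -- (0) Lüscher's transfer-matrix form for the defining representation of `SU(3)`
  have h := wilson_det_transfer_form 3 L (Matrix.specialUnitaryGroup (Fin 3) ℂ) (fundamentalRep (Fin 3))
    fundamentalRep_mem_unitaryGroup U m hm
  simp only at h
  replace h := h.1
  -- (1) the chain blocks `det E_t = det A(U_t)²`
  have h1 := fun t : ZMod L => det_chainBlock_eq_det_sliceMassHop_sq L U m t
  simp only at h1
  -- (2) the dressed one-step cores `M_t = reindex (V M_F(U_t) V⁻¹)`
  have h2 := fun t : ZMod L => dressedCore_timeSlice_eq L U m t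
  simp only at h2
  -- (3) the temporal transporters `W_t = reindex G_t`
  have h3 := fun t : ZMod L => SmitTransferForm.transporter_eq_reindex L U t
  simp only [h1, h2, h3] at h
  rw [h]
  congr 1
  -- (4) `reindex` passes through the product; the spin rotation telescopes out
  exact SmitTransferForm.det_one_sub_prod_reindex_conj
    (Equiv.uniqueProd (TorusSite 3 L × Fin 3 × Fin 4) (Fin 1))
    (sliceKron (Nf := 1) (S := L) 1 (euclideanGamma 0 * gammaFive))
    (sliceKron (Nf := 1) (S := L) 1 (gammaFive * euclideanGamma 0))
    (fun i : ℕ => fermionSliceMatrix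
      (fun e : Edge 3 L => U ((Fin.cons (i : ZMod L) e.1 : TorusSite 4 L), e.2.succ)) (fun _ : Fin 1 => m))
    (fun i : ℕ => sliceGaugeRot (Nf := 1)
      (fun y : TorusSite 3 L => U ((Fin.cons (i : ZMod L) y : TorusSite 4 L), 0)))
    L SmitTransferForm.gamma50_sliceKron_mul_gamma05_sliceKron
    SliceGammaConjugation.gamma05_sliceKron_mul_gamma50_sliceKron
    (fun i : ℕ => (sliceKron_one_mul_sliceGaugeRot_comm 1 L (euclideanGamma 0 * gammaFive)
      (fun y : TorusSite 3 L => U ((Fin.cons (i : ZMod L) y : TorusSite 4 L), 0))).symm)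

end Summit.QuantumFields.QCD.Cruxes.StableActionBridge.Sketch

end
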